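import Literature.MathematicalPhysics.QuantumFieldTheory.Balaban1983to89.B9Eq384RemainderLetters
import Literature.MathematicalPhysics.QuantumFieldTheory.Balaban1983to89.B9Eq323FlatBlockPoincare

/-!
# `Balaban1983to89.B9Thm311SmallFieldCoercivity` — T. Bałaban, *Propagators for lattice gauge theories in a background field*, Commun. Math.
# Phys. **99** (1985) 389–434 [Balaban1985BackgroundPropagators] Thm 3.11 p. 416 with (3.82)–(3.86) p. 407: THE SECOND HALF OF THM 3.11 AT A
# FIXED LATTICE — THE pub-balaban NE9 CHAIN'S PRINCIPAL GAUGE-FIXED OPERATOR `D*D + DR(U)D* + aQ(U)*Q(U)` IS COERCIVE AT EVERY SMALL FIELD `U`,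
# with the flat constant of [Balaban1984PropagatorsI] (1.72) (`B5Eq172FlatCoercivity`) halved; the `D`, `D*`, `D*D`, `Δ^η_U` and `R(U)`
# remainders PROVED, the two averaging remainders (`Q′(U)`, `Q(U)` vs flat: print's `F′₂`, `F₂` of (3.78)–(3.81)) DISPLAYED

statement-level skeleton of published theorems with citation tags; proofs where landed; nothing here is a claim about the Yang–Mills mass gap

PDF held: `paper:balaban1985-cmp99-background-propagators` (journal page = PDF page + 388), pp. 404–407, 416 read by this seat (2026-08-22).

THE PRINT (verbatim).  p. 416: *«Theorem 3.11. Under the assumptions of the Theorems 3.1–3.10 (i.e. for M sufficiently large and α₀ sufficiently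
small) the operators Δ′_a, G′, (Q′G′²Q′*)⁻¹, Δ_a, G are positive definite. … Doing the gauge transformation we get the configuration U = e^{iηA}
with A small, and by (3.86) we get G_□(e^{iηA}) = G_□(1)(I − V(A)G_□(1))⁻¹. In [4] we have proved that the operator G_□(1) is positive, hence by
the same reasoning as above we prove positivity of G_□.»*  p. 407, (3.84): *«Δ_a(U′U) = Δ_a(U) − V(A) = (I − V(A)G(U))Δ_a(U)»*.

WHY THIS FILE (cell context).  The JUNCTION of the pub-balaban NE9 owner's gen-80 files: `B5Eq172FlatCoercivity.exists_coercive_principal_of_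
near_flat` (gen 79: Thm 3.11's second half as a SHAPE — coercivity at `U` from the displayed closeness `hnear` of the assembled operator to the flat
one) receives `hnear` ASSEMBLED ((3.82)) from `B9Eq373DerivativeRemainderL2` (print's `V₁`/`V₃`), `B9Eq368ProjectionRemainder` (print's `P₁`, the
`R(U)`-remainder) and `B9Eq384RemainderLetters` (the junction algebra, the centre right inverse, the transporters of a small field) and NE9 leaf-04's
`B9Eq323FlatBlockPoincare` (the flat modulus `μ₁ = 2/(L²η²)`, explicit).  What stays DISPLAYED: the Lipschitz closeness of the AVERAGING operators `Q′(U)`, `Q(U)` to the flat ones (print's `F′₂(A)`, `F₂(A)`,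
(3.78)–(3.81), from the explicit formula (124) of [Balaban1985Averaging] — the chain's `QprimeW`, `QtorusW`), the mutual adjointness `hRS` of the
transporters read on the fibre (the display of `B9Eq310HessianOperator.principalOpK_isSymmetric`), bounds `M_φ`, `M_φ′` of the fibre identification.

WHAT IS PROVED (sorry-free; no `Prop` placeholder; no inequality of the paper asserted as a hypothesis-free fact).
* §5 **`norm_principalGF_sub_flat_le`** — (3.82) for the chain: `‖(Δ_prin(U) − Δ_prin(1))x‖ ≤ δ(εR, ρ, δ_Q, MQ, μ; d, η, a)·‖x‖`, the `hnear` of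
  E172 §6, with an EXPLICIT constant (print's `O(1)` at a fixed lattice).
* §6 **`exists_coercive_principal_of_small_field`** — `∃ γ ε₀ > 0` (finite-lattice numbers) such that for EVERY background `U` of E162's data with
  `U(b) ∈ U1`, `‖U(b) − 1‖ ≤ ε`, `hRS`, `‖Q′(U)λ − Q′(1)λ‖_∞ ≤ ρ′‖λ‖`, `‖Q(U)x − Q(1)x‖ ≤ δ_Q‖x‖` and `ε + ρ′ + δ_Q ≤ ε₀`:
  `γ‖x‖² ≤ re⟨x, (D*D + DR(U)D* + aQ(U)*Q(U))x⟩` — the `hγ` of `Support/NE9CurChartOfBackground.cur_chart_exists_of_principal_coercive`.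
MODEL / DECLARED READINGS.  (M1) as `B5Eq172FlatCoercivity`/`B9Eq326OperatorAssembly`/`B9Eq315QTorus`.  (M2) displayed: `hRS`, the two averaging
letters `ρ′`, `δ_Q`, `M_φ`, `M_φ′`; proved: everything about `D`, `D*`, `D*D`, `Δ^η_U`, `R(U)`, the flat modulus, `γ₀`.  (M3) NOT HERE: print's
UNIFORM version ((3.85)–(3.86) through Thm 3.3's decay; `γ`, `ε₀` here depend on the lattice), the GAUGE STEP of p. 416 («doing the gauge
transformation we get U = e^{iηA} with A small»: small plaquette variables (3.35) ⇒ a gauge with small bond variables, Sect. B) — the hypothesis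
here is on the bond variables in the given gauge —, the curvature part `Δ′(U)` (`B9Ineq369CurvatureSmall`), analyticity in `A`, (3.16)/(3.24)'s levels.
HONEST SCOPE.  [folklore] finite-dimensional perturbation theory reproducing the MECHANISM of p. 416 / (3.84) for the chain's OWN letters at a fixed
lattice; NOT summit progress (cell pub-balaban: NE9 NOT PRINTED / NOT PROVED; spine PROVED 0/9).  Filed by the pub-balaban NE9 BINDER-row owner
lineage `b2b-balaban-t4-ne9-p1` (gen 80); NEW file importing `B9Eq384RemainderLetters`, `B9Eq323FlatBlockPoincare`; nothing modified.  Net new unproved facts: 0.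
-/

noncomputable section

open scoped InnerProductSpace ComplexConjugate BigOperators

namespace Literature.MathematicalPhysics.QuantumFieldTheory.Balaban1983to89.B9Thm311SmallFieldCoercivity

open B4Sect5Torus (TSite)
open B9SectCLatticeCarrier (Bond)
open B7Prop1Explicit (U1 Wcx boxVec)
open B9Eq311L2Pairing (WL2)
open B9Eq319QprimeTorus (fineP centre weight Qprime_centreFun QprimeLin_apply centre_injective)
open B9Eq319Onto (centreFun)
open B11Eq103H1Complex (SiteL2K BondL2K covDerivL2K covDivL2K covLaplaceSiteK laplaceAK laplaceAK_apply laplaceALatticeK RLatticeK projR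
  equiv_covDerivL2K inner_covDivL2K_covDerivL2K)
open B9Eq310HessianOperator (adTransportW adTransportW_apply principalOpK covCurlL2K covCoCurlL2K)
open B9Eq326OperatorAssembly (RofU QprimeW)
open B9Eq315QTorus (perCfg cornerSite QtorusW)
open B5Eq172HodgePositivity (adTransportW_one coercive_of_sub_le)
open B5Eq172FlatCoercivity (QprimeW_one_const hU1_one hreg_one exists_coercive_principal_flat₀)
open B5Eq172PoincareTorus (const_of_covDeriv_eq_zero)
open B9Eq368ProjectionRemainder (norm_projR_sub_projR_le norm_projR_le exists_modulus_of_ker_inj)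
open B9Eq373DerivativeRemainderL2 (norm_adjoint_apply_le norm_covDerivL2K_sub_le norm_covDerivL2K_le norm_covDivL2K_sub_le norm_covDivL2K_le
  norm_covLaplaceSiteK_sub_le norm_covLaplaceSiteK_le norm_principal_sub_le)

open B9Eq384RemainderLetters (norm_laplaceAK_sub_le adTransportW_one_apply adTransportW_one_inv_apply hRS_one
  centreFun_add centreFun_smul QprimeW_centre norm_centre_le norm_adTransportW_sub_le)
open B9Eq323FlatBlockPoincare (exists_flat_modulus_explicit)

/-! ## §5 (3.82) for the NE9 chain: the remainder of the principal gauge-fixed operator against the flat one, ASSEMBLED -/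

section Assembly

variable {d : ℕ} (L : ℕ) [NeZero L] (m : Fin d → ℕ) [∀ i, NeZero (fineP L m i)] (hL : 1 ≤ L)
  {𝔸 : Type*} [NormedRing 𝔸] [NormedAlgebra ℂ 𝔸] [CompleteSpace 𝔸] [NormOneClass 𝔸]
  {W : Type*} [NormedAddCommGroup W] [InnerProductSpace ℂ W] [FiniteDimensional ℂ W] (φ : W ≃ₗ[ℂ] 𝔸) {c₀ c₁ : ℝ} [Fact (0 < c₀)] [Fact (0 < c₁)]
  (η : ℝ) (a : ℝ)
  (U : Bond d (fineP L m) → 𝔸ˣ) {α : ℝ} (hα1 : α ≤ 1 / 64)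
  (hU1 : ∀ (x : B7Prop1Explicit.Site d) (κ : Fin d), perCfg (fineP L m) U x κ ∈ U1 𝔸)
  (hreg : ∀ (y : TSite d m) (κ : Fin d) (r : Fin d → Fin L), ‖((Wcx L (perCfg (fineP L m) U) (cornerSite L y) κ (boxVec L r) : 𝔸ˣ) : 𝔸) - 1‖ ≤ α)

/-- **(3.82)∕(3.84) FOR THE NE9 CHAIN'S PRINCIPAL GAUGE-FIXED OPERATOR `D*D + DR(U)D* + aQ(U)*Q(U)` AGAINST THE FLAT ONE** — the displayed
closeness `hnear` of `B5Eq172FlatCoercivity.exists_coercive_principal_of_near_flat`, ASSEMBLED from: the `εR`-closeness of the transporters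
`R(U(b))`, `R(U(b)⁻¹)` to the identity (PROVED from the field in §4) and their mutual adjointness (display of `principalOpK_isSymmetric`) ⇒ the
`D*D`-part (`B9Eq373DerivativeRemainderL2`, print's `V₁`/`V₃`) and the `D`, `D*`, `Δ^η_U` letters of the `R`-part; the flat injectivity modulus `μ`
(§2, PROVED to exist) and the `ρ`-smallness of the centre lift of `Q′(U) − Q′(1)` ⇒ the `R`-part (`B9Eq368ProjectionRemainder`, print's `P₁`);
the `δ_Q`-closeness of the vector averaging `Q(U)` to `Q(1)` with a bound `MQ` of `Q(1)` ⇒ the `Q`-part (print's `P₂`/`F₂`, (3.78)–(3.81);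
DISPLAYED).  The constant is print's `O(1)` at a fixed lattice, explicit in `d`, `η⁻¹`, `εR`, `ρ`, `μ`, `δ_Q`, `MQ`, `a`.
[cite: Balaban1985BackgroundPropagators, (3.82)–(3.84) p.407, (3.70)–(3.77) pp.404–406, Thm 3.11 p.416] -/
theorem norm_principalGF_sub_flat_le {εR ρ δQ MQ μ : ℝ} (hεR : 0 ≤ εR) (hρ0 : 0 ≤ ρ) (hδQ0 : 0 ≤ δQ) (hMQ : 0 ≤ MQ) (hμ : 0 < μ)
    (hR : ∀ (b : Bond d (fineP L m)) (w : W), ‖adTransportW φ U b w - w‖ ≤ εR * ‖w‖)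
    (hRS : ∀ (b : Bond d (fineP L m)) (v u : W), ⟪adTransportW φ U b v, u⟫_ℂ = ⟪v, adTransportW φ (fun b => (U b)⁻¹) b u⟫_ℂ)
    (hmod : ∀ l : SiteL2K ℂ d (fineP L m) c₀ W, QprimeW L m φ (fun _ : Bond d (fineP L m) => (1 : 𝔸ˣ)) l = 0 →
      μ * ‖l‖ ≤ ‖covLaplaceSiteK ((η : ℂ))⁻¹ (adTransportW φ (fun _ : Bond d (fineP L m) => (1 : 𝔸ˣ)))
        (adTransportW φ fun _ : Bond d (fineP L m) => (1 : 𝔸ˣ)⁻¹) l‖)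
    (hρ : ∀ l : SiteL2K ℂ d (fineP L m) c₀ W,
      ‖(WL2.equiv ℂ (fun _ : TSite d (fineP L m) => c₀) W).symm (centreFun (weight L m) (centre L m)
        (QprimeW L m φ U l - QprimeW L m φ (fun _ : Bond d (fineP L m) => (1 : 𝔸ˣ)) l))‖ ≤ ρ * ‖l‖)
    (hQ : ∀ x : BondL2K ℂ d (fineP L m) c₀ W, ‖QtorusW L m hL φ U hα1 hU1 hreg (c₁ := c₁) x -
      QtorusW L m hL φ (fun _ => 1) (show (0 : ℝ) ≤ 1 / 64 by norm_num) (hU1_one L m) (hreg_one L m) (c₁ := c₁) x‖ ≤ δQ * ‖x‖)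
    (hQ₁ : ∀ x : BondL2K ℂ d (fineP L m) c₀ W,
      ‖QtorusW L m hL φ (fun _ => 1) (show (0 : ℝ) ≤ 1 / 64 by norm_num) (hU1_one L m) (hreg_one L m) (c₁ := c₁) x‖ ≤ MQ * ‖x‖)
    (hν : 0 < μ * (1 - ρ) - (2 * (2 + εR) * ‖((η : ℂ))⁻¹‖ ^ 2 * d * εR + 4 * (1 + εR) ^ 2 * ‖((η : ℂ))⁻¹‖ ^ 2 * d * ρ))
    (x : BondL2K ℂ d (fineP L m) c₀ W) :
    ‖laplaceALatticeK ((η : ℂ))⁻¹ (adTransportW φ U) (adTransportW φ fun b => (U b)⁻¹) (principalOpK φ η U) (RofU L m φ η U)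
        (QtorusW L m hL φ U hα1 hU1 hreg (c₁ := c₁)) a x -
      laplaceALatticeK ((η : ℂ))⁻¹ (adTransportW φ (fun _ : Bond d (fineP L m) => (1 : 𝔸ˣ)))
        (adTransportW φ fun _ : Bond d (fineP L m) => (1 : 𝔸ˣ)⁻¹) (principalOpK φ η fun _ => 1) (RofU L m φ η fun _ => 1)
        (QtorusW L m hL φ (fun _ => 1) (show (0 : ℝ) ≤ 1 / 64 by norm_num) (hU1_one L m) (hreg_one L m) (c₁ := c₁)) a x‖ ≤
      (16 * d * (2 + εR) * ‖((η : ℂ))⁻¹‖ ^ 2 * εR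
        + 2 * (2 * (1 + εR) * ‖((η : ℂ))⁻¹‖ * Real.sqrt d) * (‖((η : ℂ))⁻¹‖ * εR * Real.sqrt d)
        + (2 * (1 + εR) * ‖((η : ℂ))⁻¹‖ * Real.sqrt d) ^ 2 *
          (2 * (2 * (2 + εR) * ‖((η : ℂ))⁻¹‖ ^ 2 * d * εR + 4 * (1 + εR) ^ 2 * ‖((η : ℂ))⁻¹‖ ^ 2 * d * ρ) /
            (μ * (1 - ρ) - (2 * (2 + εR) * ‖((η : ℂ))⁻¹‖ ^ 2 * d * εR + 4 * (1 + εR) ^ 2 * ‖((η : ℂ))⁻¹‖ ^ 2 * d * ρ)))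
        + |a| * δQ * (2 * MQ + δQ)) * ‖x‖ := by
  have hc : conj ((η : ℂ))⁻¹ = ((η : ℂ))⁻¹ := by rw [map_inv₀, Complex.conj_ofReal]
  -- the flat letters act as identities
  have hR₁ : ∀ (b : Bond d (fineP L m)) (w : W), adTransportW φ (fun _ : Bond d (fineP L m) => (1 : 𝔸ˣ)) b w = w :=
    adTransportW_one_apply L m φ
  have hS₁ : ∀ (b : Bond d (fineP L m)) (w : W), adTransportW φ (fun _ : Bond d (fineP L m) => (1 : 𝔸ˣ)⁻¹) b w = w :=
    adTransportW_one_inv_apply L m φ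
  have hR₁ε : ∀ (b : Bond d (fineP L m)) (w : W), ‖adTransportW φ (fun _ : Bond d (fineP L m) => (1 : 𝔸ˣ)) b w - w‖ ≤ εR * ‖w‖ :=
    fun b w => by rw [hR₁, sub_self, norm_zero]; positivity
  have hRS₁ := hRS_one L m φ (𝔸 := 𝔸)
  -- the centre lift as a linear map
  let S₀ : (TSite d m → W) →ₗ[ℂ] SiteL2K ℂ d (fineP L m) c₀ W :=
    { toFun := fun ω => (WL2.equiv ℂ (fun _ : TSite d (fineP L m) => c₀) W).symm (centreFun (weight L m) (centre L m) ω)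
      map_add' := fun ω ω' => by rw [centreFun_add]; rfl
      map_smul' := fun r ω => by rw [centreFun_smul]; rfl }
  have hS₀ : ∀ (V : Bond d (fineP L m) → 𝔸ˣ) (f : TSite d m → W), QprimeW L m φ V (c₀ := c₀) (S₀ f) = f :=
    fun V f => QprimeW_centre L m φ V f
  -- the `R`-part
  have hM : 0 ≤ 4 * (1 + εR) ^ 2 * ‖((η : ℂ))⁻¹‖ ^ 2 * d := by positivity
  have hε : 0 ≤ 2 * (2 + εR) * ‖((η : ℂ))⁻¹‖ ^ 2 * d * εR := by positivity
  have hRdiff : ∀ z : SiteL2K ℂ d (fineP L m) c₀ W, ‖RofU L m φ η U z - RofU L m φ η (fun _ => 1) z‖ ≤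
      2 * (2 * (2 + εR) * ‖((η : ℂ))⁻¹‖ ^ 2 * d * εR + 4 * (1 + εR) ^ 2 * ‖((η : ℂ))⁻¹‖ ^ 2 * d * ρ) /
        (μ * (1 - ρ) - (2 * (2 + εR) * ‖((η : ℂ))⁻¹‖ ^ 2 * d * εR + 4 * (1 + εR) ^ 2 * ‖((η : ℂ))⁻¹‖ ^ 2 * d * ρ)) * ‖z‖ := fun z => by
    rw [norm_sub_rev]
    unfold RofU RLatticeK
    exact norm_projR_sub_projR_le _ _ _ _ S₀ S₀ (hS₀ _) (hS₀ _) hμ hM hε hρ0 hmod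
      (norm_covLaplaceSiteK_le _ hc hεR hR₁ε hRS₁) (norm_covLaplaceSiteK_le _ hc hεR hR hRS)
      (norm_covLaplaceSiteK_sub_le _ hc hεR hR hR₁ hRS hS₁) hρ
      (fun l => by
        have h : S₀ (QprimeW L m φ (fun _ : Bond d (fineP L m) => (1 : 𝔸ˣ)) l - QprimeW L m φ U l) =
            -S₀ (QprimeW L m φ U l - QprimeW L m φ (fun _ : Bond d (fineP L m) => (1 : 𝔸ˣ)) l) := by
          rw [← map_neg, neg_sub]
        rw [h, norm_neg]; exact hρ l)
      hν z
  -- the `D*D`-part in the letters `principalOpK`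
  have hP : ∀ y : BondL2K ℂ d (fineP L m) c₀ W, ‖principalOpK φ η U y - principalOpK φ η (fun _ : Bond d (fineP L m) => (1 : 𝔸ˣ)) y‖ ≤
      16 * d * (2 + εR) * ‖((η : ℂ))⁻¹‖ ^ 2 * εR * ‖y‖ := fun y => by
    rw [B9Eq310HessianOperator.principalOpK_eq_comp, B9Eq310HessianOperator.principalOpK_eq_comp, LinearMap.comp_apply,
      LinearMap.comp_apply]
    exact norm_principal_sub_le _ hc hεR hR hR₁ hRS hS₁ y
  have hδR0 : 0 ≤ 2 * (2 * (2 + εR) * ‖((η : ℂ))⁻¹‖ ^ 2 * d * εR + 4 * (1 + εR) ^ 2 * ‖((η : ℂ))⁻¹‖ ^ 2 * d * ρ) /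
      (μ * (1 - ρ) - (2 * (2 + εR) * ‖((η : ℂ))⁻¹‖ ^ 2 * d * εR + 4 * (1 + εR) ^ 2 * ‖((η : ℂ))⁻¹‖ ^ 2 * d * ρ)) :=
    div_nonneg (by positivity) hν.le
  have hRn₁ : ∀ z : SiteL2K ℂ d (fineP L m) c₀ W, ‖RofU L m φ η (fun _ : Bond d (fineP L m) => (1 : 𝔸ˣ)) z‖ ≤ ‖z‖ := fun z => by
    unfold RofU RLatticeK; exact norm_projR_le _ _ z
  have hRn₂ : ∀ z : SiteL2K ℂ d (fineP L m) c₀ W, ‖RofU L m φ η U z‖ ≤ ‖z‖ := fun z => by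
    unfold RofU RLatticeK; exact norm_projR_le _ _ z
  -- the `D`, `D*` letters
  have hD : ∀ f : SiteL2K ℂ d (fineP L m) c₀ W,
      ‖covDerivL2K ℂ c₀ ((η : ℂ))⁻¹ (adTransportW φ U) f - covDerivL2K ℂ c₀ ((η : ℂ))⁻¹ (adTransportW φ (fun _ : Bond d (fineP L m) => (1 : 𝔸ˣ))) f‖ ≤
        ‖((η : ℂ))⁻¹‖ * εR * Real.sqrt d * ‖f‖ := norm_covDerivL2K_sub_le _ hεR hR hR₁
  have hDs : ∀ y : BondL2K ℂ d (fineP L m) c₀ W,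
      ‖covDivL2K ℂ c₀ ((η : ℂ))⁻¹ (adTransportW φ fun b => (U b)⁻¹) y - covDivL2K ℂ c₀ ((η : ℂ))⁻¹ (adTransportW φ fun _ : Bond d (fineP L m) => (1 : 𝔸ˣ)⁻¹) y‖ ≤
        ‖((η : ℂ))⁻¹‖ * εR * Real.sqrt d * ‖y‖ := norm_covDivL2K_sub_le _ hc hεR hR hR₁ hRS hS₁
  have hD₁ : ∀ f : SiteL2K ℂ d (fineP L m) c₀ W,
      ‖covDerivL2K ℂ c₀ ((η : ℂ))⁻¹ (adTransportW φ (fun _ : Bond d (fineP L m) => (1 : 𝔸ˣ))) f‖ ≤ 2 * (1 + εR) * ‖((η : ℂ))⁻¹‖ * Real.sqrt d * ‖f‖ :=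
    norm_covDerivL2K_le _ hεR hR₁ε
  have hDs₂ : ∀ y : BondL2K ℂ d (fineP L m) c₀ W,
      ‖covDivL2K ℂ c₀ ((η : ℂ))⁻¹ (adTransportW φ fun b => (U b)⁻¹) y‖ ≤ 2 * (1 + εR) * ‖((η : ℂ))⁻¹‖ * Real.sqrt d * ‖y‖ :=
    norm_covDivL2K_le _ hc hεR hR hRS
  have hMD : (0 : ℝ) ≤ 2 * (1 + εR) * ‖((η : ℂ))⁻¹‖ * Real.sqrt d := by positivity
  have hδD : (0 : ℝ) ≤ ‖((η : ℂ))⁻¹‖ * εR * Real.sqrt d := by positivity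
  -- the assembly (the real constant is closed by `ring`, not by unification)
  have key := @norm_laplaceAK_sub_le ℂ _ (BondL2K ℂ d (fineP L m) c₀ W) (SiteL2K ℂ d (fineP L m) c₀ W) (BondL2K ℂ d m c₁ W)
    _ _ _ _ _ _ _ _ (principalOpK φ η fun _ : Bond d (fineP L m) => (1 : 𝔸ˣ)) (principalOpK φ η U)
    (covDerivL2K ℂ c₀ ((η : ℂ))⁻¹ (adTransportW φ (fun _ : Bond d (fineP L m) => (1 : 𝔸ˣ))))
    (covDerivL2K ℂ c₀ ((η : ℂ))⁻¹ (adTransportW φ U))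
    (RofU L m φ η fun _ : Bond d (fineP L m) => (1 : 𝔸ˣ)) (RofU L m φ η U)
    (covDivL2K ℂ c₀ ((η : ℂ))⁻¹ (adTransportW φ fun _ : Bond d (fineP L m) => (1 : 𝔸ˣ)⁻¹))
    (covDivL2K ℂ c₀ ((η : ℂ))⁻¹ (adTransportW φ fun b => (U b)⁻¹))
    (QtorusW L m hL φ (fun _ => 1) (show (0 : ℝ) ≤ 1 / 64 by norm_num) (hU1_one L m) (hreg_one L m) (c₁ := c₁))
    (QtorusW L m hL φ U hα1 hU1 hreg (c₁ := c₁)) a _ _ _ _ _ _ hMD hMQ hδD hδR0 hδQ0 hP hD hDs hD₁ hDs₂ hRn₁ hRn₂ hRdiff hQ hQ₁ x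
  refine key.trans (le_of_eq ?_)
  ring

/-! ## §6 [B9] Thm 3.11's second half at a fixed lattice: `∃ γ ε₀ > 0` -/

/-- arithmetic helper: `t ≤ μ/(2B+1)` gives `B·t ≤ μ/2`. [folklore] -/
private theorem mul_le_half_of_le_div {B μ t : ℝ} (hB : 0 ≤ B) (hμ : 0 ≤ μ) (ht : t ≤ μ / (2 * B + 1)) : B * t ≤ μ / 2 := by
  have h1 : B * t ≤ B * (μ / (2 * B + 1)) := mul_le_mul_of_nonneg_left ht hB
  have h2 : B * (μ / (2 * B + 1)) ≤ μ / 2 := by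
    rw [mul_div_assoc', div_le_div_iff₀ (by positivity) (by norm_num)]
    nlinarith
  exact h1.trans h2
set_option maxHeartbeats 400000 in
/-- **[B9] THM 3.11, SECOND HALF, AT A FIXED LATTICE: THE PRINCIPAL GAUGE-FIXED OPERATOR IS UNIFORMLY COERCIVE AT EVERY SMALL FIELD** —
p. 416: *«Doing the gauge transformation we get the configuration U = e^{iηA} with A small, and by (3.86) we get G_□(e^{iηA}) = G_□(1)(I −
V(A)G_□(1))⁻¹. In [4] we have proved that the operator G_□(1) is positive, hence … we prove positivity of G_□»* — for the NE9 chain's letters: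
THERE ARE `γ, ε₀ > 0` (finite-lattice numbers: the flat constant `γ₀` of [B5] (1.72) ∕ `B5Eq172FlatCoercivity`, the flat modulus `μ₁` of §2, the
operator norm of `Q(1)`, `d`, `η`, `L`, `c₀`, `a`, `M_φ`, `M_φ′`) such that for EVERY background `U` of E162's data with unit-bounded bond variables
whose field is `ε`-small (`‖U(b) − 1‖ ≤ ε`), whose transporters are mutually adjoint in the norming inner product (`hRS`, the display of
`principalOpK_isSymmetric`), and whose AVERAGING operators are Lipschitz-close to the flat ones — `‖Q′(U)λ − Q′(1)λ‖_∞ ≤ ρ′‖λ‖` and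
`‖Q(U)x − Q(1)x‖ ≤ δ_Q‖x‖` (print's `F′₂`, `F₂` of (3.78)–(3.81), [Balaban1985Averaging] (124)/(140)–(143); DISPLAYED, not proved here) — with
`ε + ρ′ + δ_Q ≤ ε₀`, the coercivity `γ‖x‖² ≤ re⟨x, (D*D + DR(U)D* + aQ(U)*Q(U))x⟩` HOLDS: the `hγ` of
`Support/NE9CurChartOfBackground.cur_chart_exists_of_principal_coercive`.  The `D`, `D*`, `D*D`, `Δ^η_U` remainders (print's `V₁`–`V₃`) and the
`R(U)` remainder (print's `P₁`) are PROVED (`B9Eq373DerivativeRemainderL2`, `B9Eq368ProjectionRemainder`); no uniformity in the lattice (print's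
(3.85)–(3.86) via Thm 3.3 is not touched). [cite: Balaban1985BackgroundPropagators, Thm 3.11 p.416, (3.82)–(3.86) p.407; Balaban1984PropagatorsI, (1.72) p.30] -/
theorem exists_coercive_principal_of_small_field {η : ℝ} (hη : η ≠ 0) {a : ℝ} (ha : 0 < a) {Mφ Mφ' : ℝ} (hMφ : 0 ≤ Mφ) (hMφ' : 0 ≤ Mφ')
    (hφ : ∀ w, ‖φ w‖ ≤ Mφ * ‖w‖) (hφ' : ∀ X, ‖φ.symm X‖ ≤ Mφ' * ‖X‖) :
    ∃ γ ε₀ : ℝ, 0 < γ ∧ 0 < ε₀ ∧ ∀ (U : Bond d (fineP L m) → 𝔸ˣ) {α : ℝ} (hα1 : α ≤ 1 / 64)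
      (hU1 : ∀ (x : B7Prop1Explicit.Site d) (κ : Fin d), perCfg (fineP L m) U x κ ∈ U1 𝔸)
      (hreg : ∀ (y : TSite d m) (κ : Fin d) (r : Fin d → Fin L), ‖((Wcx L (perCfg (fineP L m) U) (cornerSite L y) κ (boxVec L r) : 𝔸ˣ) : 𝔸) - 1‖ ≤ α)
      {ε ρ' δQ : ℝ}, 0 ≤ ε → 0 ≤ ρ' → 0 ≤ δQ → ε + ρ' + δQ ≤ ε₀ →
      (∀ b, U b ∈ U1 𝔸) → (∀ b, ‖(U b : 𝔸) - 1‖ ≤ ε) →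
      (∀ (b : Bond d (fineP L m)) (v u : W), ⟪adTransportW φ U b v, u⟫_ℂ = ⟪v, adTransportW φ (fun b => (U b)⁻¹) b u⟫_ℂ) →
      (∀ l : SiteL2K ℂ d (fineP L m) c₀ W, ‖QprimeW L m φ U l - QprimeW L m φ (fun _ : Bond d (fineP L m) => (1 : 𝔸ˣ)) l‖ ≤ ρ' * ‖l‖) →
      (∀ x : BondL2K ℂ d (fineP L m) c₀ W, ‖QtorusW L m hL φ U hα1 hU1 hreg (c₁ := c₁) x -
        QtorusW L m hL φ (fun _ => 1) (show (0 : ℝ) ≤ 1 / 64 by norm_num) (hU1_one L m) (hreg_one L m) (c₁ := c₁) x‖ ≤ δQ * ‖x‖) →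
      ∀ x : BondL2K ℂ d (fineP L m) c₀ W, γ * ‖x‖ ^ 2 ≤
        RCLike.re ⟪x, laplaceALatticeK ((η : ℂ))⁻¹ (adTransportW φ U) (adTransportW φ fun b => (U b)⁻¹) (principalOpK φ η U) (RofU L m φ η U)
          (QtorusW L m hL φ U hα1 hU1 hreg (c₁ := c₁)) a x⟫_ℂ := by
  have hc₀ : 0 < c₀ := Fact.out
  -- the flat constants: `γ₀` ([B5] (1.72)), `μ` (§2), `MQ = ‖Q(1)‖`
  obtain ⟨γ₀, hγ₀, hflat⟩ := B5Eq172FlatCoercivity.exists_coercive_principal_of_near_flat L m hL φ (c₀ := c₀) (c₁ := c₁) hη ha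
  obtain ⟨μ, hμ, hmod⟩ := exists_flat_modulus_explicit L m φ (c₀ := c₀) hη
  obtain ⟨MQ, hMQdef⟩ : ∃ MQ : ℝ, MQ = ‖LinearMap.toContinuousLinearMap
    (QtorusW L m hL φ (fun _ => 1) (show (0 : ℝ) ≤ 1 / 64 by norm_num) (hU1_one L m) (hreg_one L m) (c₀ := c₀) (c₁ := c₁))‖ := ⟨_, rfl⟩
  have hMQ : 0 ≤ MQ := by
    rw [hMQdef]
    exact norm_nonneg (LinearMap.toContinuousLinearMap
      (QtorusW L m hL φ (fun _ => 1) (show (0 : ℝ) ≤ 1 / 64 by norm_num) (hU1_one L m) (hreg_one L m) (c₀ := c₀) (c₁ := c₁)))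
  have hQ₁ : ∀ x : BondL2K ℂ d (fineP L m) c₀ W,
      ‖QtorusW L m hL φ (fun _ => 1) (show (0 : ℝ) ≤ 1 / 64 by norm_num) (hU1_one L m) (hreg_one L m) (c₀ := c₀) (c₁ := c₁) x‖ ≤ MQ * ‖x‖ :=
    fun x => by
      rw [hMQdef]
      exact (LinearMap.toContinuousLinearMap
        (QtorusW L m hL φ (fun _ => 1) (show (0 : ℝ) ≤ 1 / 64 by norm_num) (hU1_one L m) (hreg_one L m) (c₀ := c₀) (c₁ := c₁))).le_opNorm x
  -- the lattice constants
  have hnc : 0 ≤ ‖((η : ℂ))⁻¹‖ := norm_nonneg _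
  obtain ⟨KR, hKRdef⟩ : ∃ KR : ℝ, KR = 2 * Mφ * Mφ' := ⟨_, rfl⟩
  have hKR : 0 ≤ KR := by rw [hKRdef]; positivity
  obtain ⟨CS, hCSdef⟩ : ∃ CS : ℝ, CS = (L : ℝ) ^ d * Real.sqrt (c₀ * Fintype.card (TSite d (fineP L m))) := ⟨_, rfl⟩
  have hCS : 0 ≤ CS := by rw [hCSdef]; positivity
  obtain ⟨B, hBdef⟩ : ∃ B : ℝ, B = μ * CS + 6 * ‖((η : ℂ))⁻¹‖ ^ 2 * d * KR + 16 * ‖((η : ℂ))⁻¹‖ ^ 2 * d * CS := ⟨_, rfl⟩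
  have hB : 0 ≤ B := by rw [hBdef]; positivity
  obtain ⟨K, hKdef⟩ : ∃ K : ℝ, K = 48 * d * ‖((η : ℂ))⁻¹‖ ^ 2 * KR + 8 * ‖((η : ℂ))⁻¹‖ ^ 2 * d * KR + 64 * ‖((η : ℂ))⁻¹‖ ^ 2 * d * (6 * ‖((η : ℂ))⁻¹‖ ^ 2 * d * KR + 16 * ‖((η : ℂ))⁻¹‖ ^ 2 * d * CS) / μ
    + |a| * (2 * MQ + 1) := ⟨_, rfl⟩
  have hK : 0 ≤ K := by rw [hKdef]; positivity
  refine ⟨γ₀ / 2, min (1 / (KR + 1)) (min (μ / (2 * B + 1)) (γ₀ / (2 * K + 1))), by positivity, by positivity, ?_⟩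
  intro U α hα1 hU1 hreg ε ρ' δQ hε hρ' hδQ ht hUb hUε hRS hQ' hQ x
  -- `t = ε + ρ′ + δ_Q` and its three consequences
  have ht1 : ε + ρ' + δQ ≤ 1 / (KR + 1) := ht.trans (min_le_left _ _)
  have ht2 : ε + ρ' + δQ ≤ μ / (2 * B + 1) := ht.trans ((min_le_right _ _).trans (min_le_left _ _))
  have ht3 : ε + ρ' + δQ ≤ γ₀ / (2 * K + 1) := ht.trans ((min_le_right _ _).trans (min_le_right _ _))
  have hεt : ε ≤ ε + ρ' + δQ := by linarith
  have hρt : ρ' ≤ ε + ρ' + δQ := by linarith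
  have hδQt : δQ ≤ ε + ρ' + δQ := by linarith
  have ht01 : ε + ρ' + δQ ≤ 1 := ht1.trans (by rw [div_le_one (by positivity)]; linarith)
  have hδQ1 : δQ ≤ 1 := hδQt.trans ht01
  -- the letters of `coercive_of_remainder_le`
  obtain ⟨εR, hεRdef⟩ : ∃ εR : ℝ, εR = KR * ε := ⟨_, rfl⟩
  have hεR : 0 ≤ εR := by rw [hεRdef]; positivity
  have hεRt : εR ≤ KR * (ε + ρ' + δQ) := by rw [hεRdef]; exact mul_le_mul_of_nonneg_left hεt hKR
  have hεR1 : εR ≤ 1 := by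
    refine hεRt.trans ((mul_le_mul_of_nonneg_left ht1 hKR).trans ?_)
    rw [mul_one_div, div_le_one (by positivity)]; linarith
  have hR : ∀ (b : Bond d (fineP L m)) (w : W), ‖adTransportW φ U b w - w‖ ≤ εR * ‖w‖ := fun b w => by
    have h := norm_adTransportW_sub_le φ hφ hφ' hMφ' U b (hUb b) (hUε b) w
    rw [hεRdef, hKRdef]; linarith
  obtain ⟨ρ, hρdef⟩ : ∃ ρ : ℝ, ρ = CS * ρ' := ⟨_, rfl⟩
  have hρ0 : 0 ≤ ρ := by rw [hρdef]; positivity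
  have hρ : ∀ l : SiteL2K ℂ d (fineP L m) c₀ W,
      ‖(WL2.equiv ℂ (fun _ : TSite d (fineP L m) => c₀) W).symm (centreFun (weight L m) (centre L m)
        (QprimeW L m φ U l - QprimeW L m φ (fun _ : Bond d (fineP L m) => (1 : 𝔸ˣ)) l))‖ ≤ ρ * ‖l‖ := fun l =>
    (norm_centre_le L m _).trans (by
      rw [← hCSdef]
      calc CS * ‖QprimeW L m φ U l - QprimeW L m φ (fun _ : Bond d (fineP L m) => (1 : 𝔸ˣ)) l‖ ≤ CS * (ρ' * ‖l‖) :=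
            mul_le_mul_of_nonneg_left (hQ' l) hCS
        _ = ρ * ‖l‖ := by rw [hρdef]; ring)
  have hρt : ρ ≤ CS * (ε + ρ' + δQ) := by rw [hρdef]; exact mul_le_mul_of_nonneg_left hρt hCS
  -- the smallness bookkeeping: `εΔ + Mρ + μρ ≤ B·t ≤ μ/2`
  have hd0 : (0 : ℝ) ≤ d := Nat.cast_nonneg d
  have hsd : Real.sqrt d * Real.sqrt d = d := Real.mul_self_sqrt hd0
  have hεΔ : 2 * (2 + εR) * ‖((η : ℂ))⁻¹‖ ^ 2 * d * εR ≤ 6 * ‖((η : ℂ))⁻¹‖ ^ 2 * d * KR * (ε + ρ' + δQ) := by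
    have h1 : 2 * (2 + εR) ≤ 6 := by linarith
    calc 2 * (2 + εR) * ‖((η : ℂ))⁻¹‖ ^ 2 * d * εR = (2 * (2 + εR)) * (‖((η : ℂ))⁻¹‖ ^ 2 * d * εR) := by ring
      _ ≤ 6 * (‖((η : ℂ))⁻¹‖ ^ 2 * d * (KR * (ε + ρ' + δQ))) :=
          mul_le_mul h1 (mul_le_mul_of_nonneg_left hεRt (by positivity)) (by positivity) (by norm_num)
      _ = 6 * ‖((η : ℂ))⁻¹‖ ^ 2 * d * KR * (ε + ρ' + δQ) := by ring
  have hM16 : 4 * (1 + εR) ^ 2 * ‖((η : ℂ))⁻¹‖ ^ 2 * d ≤ 16 * ‖((η : ℂ))⁻¹‖ ^ 2 * d := by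
    have h1 : (1 + εR) ^ 2 ≤ 4 := by
      calc (1 + εR) ^ 2 ≤ 2 ^ 2 := pow_le_pow_left₀ (by positivity) (by linarith) 2
        _ = 4 := by norm_num
    calc 4 * (1 + εR) ^ 2 * ‖((η : ℂ))⁻¹‖ ^ 2 * d = (1 + εR) ^ 2 * (4 * ‖((η : ℂ))⁻¹‖ ^ 2 * d) := by ring
      _ ≤ 4 * (4 * ‖((η : ℂ))⁻¹‖ ^ 2 * d) := mul_le_mul_of_nonneg_right h1 (by positivity)
      _ = 16 * ‖((η : ℂ))⁻¹‖ ^ 2 * d := by ring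
  have hMρ : 4 * (1 + εR) ^ 2 * ‖((η : ℂ))⁻¹‖ ^ 2 * d * ρ ≤ 16 * ‖((η : ℂ))⁻¹‖ ^ 2 * d * CS * (ε + ρ' + δQ) :=
    calc 4 * (1 + εR) ^ 2 * ‖((η : ℂ))⁻¹‖ ^ 2 * d * ρ ≤ 16 * ‖((η : ℂ))⁻¹‖ ^ 2 * d * ρ := mul_le_mul_of_nonneg_right hM16 hρ0
      _ ≤ 16 * ‖((η : ℂ))⁻¹‖ ^ 2 * d * (CS * (ε + ρ' + δQ)) := mul_le_mul_of_nonneg_left hρt (by positivity)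
      _ = 16 * ‖((η : ℂ))⁻¹‖ ^ 2 * d * CS * (ε + ρ' + δQ) := by ring
  have hμρ : μ * ρ ≤ μ * CS * (ε + ρ' + δQ) := by
    rw [mul_assoc]; exact mul_le_mul_of_nonneg_left hρt hμ.le
  have hBt : B * (ε + ρ' + δQ) ≤ μ / 2 := mul_le_half_of_le_div hB hμ.le ht2
  have hsum : μ * ρ + (2 * (2 + εR) * ‖((η : ℂ))⁻¹‖ ^ 2 * d * εR + 4 * (1 + εR) ^ 2 * ‖((η : ℂ))⁻¹‖ ^ 2 * d * ρ) ≤ μ / 2 := by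
    have : μ * CS * (ε + ρ' + δQ) + (6 * ‖((η : ℂ))⁻¹‖ ^ 2 * d * KR * (ε + ρ' + δQ) + 16 * ‖((η : ℂ))⁻¹‖ ^ 2 * d * CS * (ε + ρ' + δQ)) = B * (ε + ρ' + δQ) := by
      rw [hBdef]; ring
    linarith [hμρ, hεΔ, hMρ]
  have hrew : μ * (1 - ρ) - (2 * (2 + εR) * ‖((η : ℂ))⁻¹‖ ^ 2 * d * εR + 4 * (1 + εR) ^ 2 * ‖((η : ℂ))⁻¹‖ ^ 2 * d * ρ) =
      μ - (μ * ρ + (2 * (2 + εR) * ‖((η : ℂ))⁻¹‖ ^ 2 * d * εR + 4 * (1 + εR) ^ 2 * ‖((η : ℂ))⁻¹‖ ^ 2 * d * ρ)) := by ring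
  have hν2 : μ / 2 ≤ μ * (1 - ρ) - (2 * (2 + εR) * ‖((η : ℂ))⁻¹‖ ^ 2 * d * εR + 4 * (1 + εR) ^ 2 * ‖((η : ℂ))⁻¹‖ ^ 2 * d * ρ) := by
    rw [hrew]; linarith
  have hν : 0 < μ * (1 - ρ) - (2 * (2 + εR) * ‖((η : ℂ))⁻¹‖ ^ 2 * d * εR + 4 * (1 + εR) ^ 2 * ‖((η : ℂ))⁻¹‖ ^ 2 * d * ρ) :=
    lt_of_lt_of_le (by positivity) hν2
  -- the `R`-remainder: `δR ≤ 4(εΔ + Mρ)/μ ≤ 4(6nc²dK_R + 16nc²dC_S)t/μ`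
  have hδR : 2 * (2 * (2 + εR) * ‖((η : ℂ))⁻¹‖ ^ 2 * d * εR + 4 * (1 + εR) ^ 2 * ‖((η : ℂ))⁻¹‖ ^ 2 * d * ρ) /
      (μ * (1 - ρ) - (2 * (2 + εR) * ‖((η : ℂ))⁻¹‖ ^ 2 * d * εR + 4 * (1 + εR) ^ 2 * ‖((η : ℂ))⁻¹‖ ^ 2 * d * ρ)) ≤
      4 * (6 * ‖((η : ℂ))⁻¹‖ ^ 2 * d * KR + 16 * ‖((η : ℂ))⁻¹‖ ^ 2 * d * CS) * (ε + ρ' + δQ) / μ := by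
    have hnum : 0 ≤ 2 * (2 * (2 + εR) * ‖((η : ℂ))⁻¹‖ ^ 2 * d * εR + 4 * (1 + εR) ^ 2 * ‖((η : ℂ))⁻¹‖ ^ 2 * d * ρ) := by positivity
    calc _ ≤ 2 * (2 * (2 + εR) * ‖((η : ℂ))⁻¹‖ ^ 2 * d * εR + 4 * (1 + εR) ^ 2 * ‖((η : ℂ))⁻¹‖ ^ 2 * d * ρ) / (μ / 2) :=
          div_le_div_of_nonneg_left hnum (by positivity) hν2
      _ = 4 * (2 * (2 + εR) * ‖((η : ℂ))⁻¹‖ ^ 2 * d * εR + 4 * (1 + εR) ^ 2 * ‖((η : ℂ))⁻¹‖ ^ 2 * d * ρ) / μ := by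
          field_simp; ring
      _ ≤ 4 * (6 * ‖((η : ℂ))⁻¹‖ ^ 2 * d * KR * (ε + ρ' + δQ) + 16 * ‖((η : ℂ))⁻¹‖ ^ 2 * d * CS * (ε + ρ' + δQ)) / μ := by
          gcongr
      _ = 4 * (6 * ‖((η : ℂ))⁻¹‖ ^ 2 * d * KR + 16 * ‖((η : ℂ))⁻¹‖ ^ 2 * d * CS) * (ε + ρ' + δQ) / μ := by ring
  -- the four pieces of the remainder constant against `K·t`
  have hP' : 16 * d * (2 + εR) * ‖((η : ℂ))⁻¹‖ ^ 2 * εR ≤ 48 * d * ‖((η : ℂ))⁻¹‖ ^ 2 * KR * (ε + ρ' + δQ) := by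
    have h1 : 2 + εR ≤ 3 := by linarith
    calc 16 * d * (2 + εR) * ‖((η : ℂ))⁻¹‖ ^ 2 * εR = (16 * d * ‖((η : ℂ))⁻¹‖ ^ 2) * ((2 + εR) * εR) := by ring
      _ ≤ (16 * d * ‖((η : ℂ))⁻¹‖ ^ 2) * (3 * (KR * (ε + ρ' + δQ))) :=
          mul_le_mul_of_nonneg_left (mul_le_mul h1 hεRt hεR (by norm_num)) (by positivity)
      _ = 48 * d * ‖((η : ℂ))⁻¹‖ ^ 2 * KR * (ε + ρ' + δQ) := by ring
  have hD' : 2 * (2 * (1 + εR) * ‖((η : ℂ))⁻¹‖ * Real.sqrt d) * (‖((η : ℂ))⁻¹‖ * εR * Real.sqrt d) ≤ 8 * ‖((η : ℂ))⁻¹‖ ^ 2 * d * KR * (ε + ρ' + δQ) := by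
    have h1 : 1 + εR ≤ 2 := by linarith
    calc 2 * (2 * (1 + εR) * ‖((η : ℂ))⁻¹‖ * Real.sqrt d) * (‖((η : ℂ))⁻¹‖ * εR * Real.sqrt d) = 4 * ‖((η : ℂ))⁻¹‖ ^ 2 * (Real.sqrt d * Real.sqrt d) * ((1 + εR) * εR) := by ring
      _ = 4 * ‖((η : ℂ))⁻¹‖ ^ 2 * d * ((1 + εR) * εR) := by rw [hsd]
      _ ≤ 4 * ‖((η : ℂ))⁻¹‖ ^ 2 * d * (2 * (KR * (ε + ρ' + δQ))) :=
          mul_le_mul_of_nonneg_left (mul_le_mul h1 hεRt hεR (by norm_num)) (by positivity)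
      _ = 8 * ‖((η : ℂ))⁻¹‖ ^ 2 * d * KR * (ε + ρ' + δQ) := by ring
  have hR' : (2 * (1 + εR) * ‖((η : ℂ))⁻¹‖ * Real.sqrt d) ^ 2 *
      (2 * (2 * (2 + εR) * ‖((η : ℂ))⁻¹‖ ^ 2 * d * εR + 4 * (1 + εR) ^ 2 * ‖((η : ℂ))⁻¹‖ ^ 2 * d * ρ) /
        (μ * (1 - ρ) - (2 * (2 + εR) * ‖((η : ℂ))⁻¹‖ ^ 2 * d * εR + 4 * (1 + εR) ^ 2 * ‖((η : ℂ))⁻¹‖ ^ 2 * d * ρ))) ≤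
      64 * ‖((η : ℂ))⁻¹‖ ^ 2 * d * (6 * ‖((η : ℂ))⁻¹‖ ^ 2 * d * KR + 16 * ‖((η : ℂ))⁻¹‖ ^ 2 * d * CS) / μ * (ε + ρ' + δQ) := by
    have hsq : (2 * (1 + εR) * ‖((η : ℂ))⁻¹‖ * Real.sqrt d) ^ 2 = 4 * (1 + εR) ^ 2 * ‖((η : ℂ))⁻¹‖ ^ 2 * d := by
      rw [show (2 * (1 + εR) * ‖((η : ℂ))⁻¹‖ * Real.sqrt d) ^ 2 = 4 * (1 + εR) ^ 2 * ‖((η : ℂ))⁻¹‖ ^ 2 * (Real.sqrt d * Real.sqrt d) by ring, hsd]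
    rw [hsq]
    have hδR0 : 0 ≤ 2 * (2 * (2 + εR) * ‖((η : ℂ))⁻¹‖ ^ 2 * d * εR + 4 * (1 + εR) ^ 2 * ‖((η : ℂ))⁻¹‖ ^ 2 * d * ρ) /
        (μ * (1 - ρ) - (2 * (2 + εR) * ‖((η : ℂ))⁻¹‖ ^ 2 * d * εR + 4 * (1 + εR) ^ 2 * ‖((η : ℂ))⁻¹‖ ^ 2 * d * ρ)) := div_nonneg (by positivity) hν.le
    calc 4 * (1 + εR) ^ 2 * ‖((η : ℂ))⁻¹‖ ^ 2 * d * (2 * (2 * (2 + εR) * ‖((η : ℂ))⁻¹‖ ^ 2 * d * εR + 4 * (1 + εR) ^ 2 * ‖((η : ℂ))⁻¹‖ ^ 2 * d * ρ) /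
          (μ * (1 - ρ) - (2 * (2 + εR) * ‖((η : ℂ))⁻¹‖ ^ 2 * d * εR + 4 * (1 + εR) ^ 2 * ‖((η : ℂ))⁻¹‖ ^ 2 * d * ρ)))
        ≤ 16 * ‖((η : ℂ))⁻¹‖ ^ 2 * d * (4 * (6 * ‖((η : ℂ))⁻¹‖ ^ 2 * d * KR + 16 * ‖((η : ℂ))⁻¹‖ ^ 2 * d * CS) * (ε + ρ' + δQ) / μ) :=
          mul_le_mul hM16 hδR hδR0 (by positivity)
      _ = 64 * ‖((η : ℂ))⁻¹‖ ^ 2 * d * (6 * ‖((η : ℂ))⁻¹‖ ^ 2 * d * KR + 16 * ‖((η : ℂ))⁻¹‖ ^ 2 * d * CS) / μ * (ε + ρ' + δQ) := by ring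
  have hQ'' : |a| * δQ * (2 * MQ + δQ) ≤ |a| * (2 * MQ + 1) * (ε + ρ' + δQ) := by
    have h1 : 2 * MQ + δQ ≤ 2 * MQ + 1 := by linarith
    calc |a| * δQ * (2 * MQ + δQ) = |a| * (δQ * (2 * MQ + δQ)) := by ring
      _ ≤ |a| * ((ε + ρ' + δQ) * (2 * MQ + 1)) :=
          mul_le_mul_of_nonneg_left (mul_le_mul hδQt h1 (by positivity) (by positivity)) (abs_nonneg a)
      _ = |a| * (2 * MQ + 1) * (ε + ρ' + δQ) := by ring
  have hKt : K * (ε + ρ' + δQ) ≤ γ₀ / 2 := mul_le_half_of_le_div hK hγ₀.le ht3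
  have hδ : 16 * d * (2 + εR) * ‖((η : ℂ))⁻¹‖ ^ 2 * εR
      + 2 * (2 * (1 + εR) * ‖((η : ℂ))⁻¹‖ * Real.sqrt d) * (‖((η : ℂ))⁻¹‖ * εR * Real.sqrt d)
      + (2 * (1 + εR) * ‖((η : ℂ))⁻¹‖ * Real.sqrt d) ^ 2 *
        (2 * (2 * (2 + εR) * ‖((η : ℂ))⁻¹‖ ^ 2 * d * εR + 4 * (1 + εR) ^ 2 * ‖((η : ℂ))⁻¹‖ ^ 2 * d * ρ) /
          (μ * (1 - ρ) - (2 * (2 + εR) * ‖((η : ℂ))⁻¹‖ ^ 2 * d * εR + 4 * (1 + εR) ^ 2 * ‖((η : ℂ))⁻¹‖ ^ 2 * d * ρ)))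
      + |a| * δQ * (2 * MQ + δQ) ≤ γ₀ / 2 := by
    have hKsum : 48 * d * ‖((η : ℂ))⁻¹‖ ^ 2 * KR * (ε + ρ' + δQ) + 8 * ‖((η : ℂ))⁻¹‖ ^ 2 * d * KR * (ε + ρ' + δQ)
        + 64 * ‖((η : ℂ))⁻¹‖ ^ 2 * d * (6 * ‖((η : ℂ))⁻¹‖ ^ 2 * d * KR + 16 * ‖((η : ℂ))⁻¹‖ ^ 2 * d * CS) / μ * (ε + ρ' + δQ) + |a| * (2 * MQ + 1) * (ε + ρ' + δQ)
        = K * (ε + ρ' + δQ) := by rw [hKdef]; ring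
    calc _ ≤ 48 * d * ‖((η : ℂ))⁻¹‖ ^ 2 * KR * (ε + ρ' + δQ) + 8 * ‖((η : ℂ))⁻¹‖ ^ 2 * d * KR * (ε + ρ' + δQ)
        + 64 * ‖((η : ℂ))⁻¹‖ ^ 2 * d * (6 * ‖((η : ℂ))⁻¹‖ ^ 2 * d * KR + 16 * ‖((η : ℂ))⁻¹‖ ^ 2 * d * CS) / μ * (ε + ρ' + δQ)
        + |a| * (2 * MQ + 1) * (ε + ρ' + δQ) := add_le_add (add_le_add (add_le_add hP' hD') hR') hQ''
      _ = K * (ε + ρ' + δQ) := hKsum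
      _ ≤ γ₀ / 2 := hKt
  -- conclusion: `γ₀ − γ₀/2 = γ₀/2`
  have h := hflat (γ₀ / 2) U hα1 hU1 hreg (fun y =>
    (norm_principalGF_sub_flat_le L m hL φ η a U hα1 hU1 hreg hεR hρ0 hδQ hMQ hμ hR hRS hmod hρ hQ hQ₁ hν y).trans
      (mul_le_mul_of_nonneg_right hδ (norm_nonneg _))) x
  have h2 : γ₀ / 2 = γ₀ - γ₀ / 2 := by ring
  rw [h2]
  exact h

end Assembly



end Literature.MathematicalPhysics.QuantumFieldTheory.Balaban1983to89.B9Thm311SmallFieldCoercivity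

end
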